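import Summits.HubbardSuperconductivity.HubbardSuperconductivity.Theses.BalabanIR
import Literature.MathematicalPhysics.QuantumLattice.GibbsEntropy
import Literature.MathematicalPhysics.QuantumLattice.DuhamelTwoPoint

/-!
# Sketch (crux-ideate, ideator 2, round 1) — crux `BalabanIR.BirGroundStateAverageLRO`
(item stmt-HubbardSuperconductivity-2079)

First lemmas of the two idea cards, typed over existing declarations (§0 and the first inequality
`softmin_le_expect` are PROVED sorry-free; the remaining proofs are `sorry`, the card texts give the
3-line arguments). Nothing here is a route item.

* §1 SOFTMIN TRANSFER (card `softmin-pair-penalty`): for Hermitian `H`, `B`, `β > 0`, an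
  `H`-invariant Hermitian idempotent `P` (a sector), and a unit vector `ψ` in the sector with
  `H ψ = e ψ`:
    `-(1/β) log Re tr (P e^{-β(H - e + B)}) ≤ Re ⟨ψ, B ψ⟩`            (Peierls for the vector state),
  and if `e` is the lowest energy of `H` on the sector,
    `Re ⟨B⟩^P_{β,H+B} - log(Re tr P)/β ≤ -(1/β) log Re tr (P e^{-β(H - e + B)})`   (Gibbs variational
  principle, crude entropy `S ≤ log dim`), as well as the entropy-priced form with a hypothesis
  `log Re tr(P e^{-β(H-e)}) ≤ σ` in place of `log dim`.
* §2 the typed transfer target `PenalisedThermalFloor` (C⁺ of the card) over `hubbardTorus`,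
  `szSector`, `projMatrix`, `Matrix.gibbsWeight`, `pairField dWaveFormFactor`, and the transfer
  signature `PenalisedThermalFloor … → BirGroundStateAverageLRO` (via every ground state and the
  landed `Theorems.birGroundStateAverageLRO_of_forall_groundState`).
* §3 SHRINKING-CIRCLE DELIVERY (card `shrinking-circle-delivery`): the sector trace as a Fourier
  coefficient of particle-number-twisted traces (characters of `U(1)`), the identity through which a
  grand-canonical engine feeds §2.
-/

noncomputable section

/-! ## §0 Proved: Peierls–Jensen in a sector and the softmin inequality (sorry-free)
Helper lemmas in namespace `Matrix` (dot-notation on `IsHermitian`/`PosSemidef`); used by §1 `softmin_le_expect`. -/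

section SoftminProved
open scoped ComplexOrder
open Finset Literature.MathematicalPhysics.QuantumLattice

namespace Matrix

variable {n : Type*} [Fintype n] [DecidableEq n]

/-- `⟨ψ, U diag(d) U⋆ ψ⟩ = Σᵢ dᵢ ‖(U⋆ψ)ᵢ‖²` (as a real part). [folklore] -/
theorem re_quadForm_conj_diagonal (U : Matrix n n ℂ) (d : n → ℝ) (ψ : n → ℂ) :
    (star ψ ⬝ᵥ ((U * diagonal (fun i => (d i : ℂ)) * star U) *ᵥ ψ)).re =
      ∑ i, d i * ‖(star U *ᵥ ψ) i‖ ^ 2 := by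
  set φ : n → ℂ := star U *ᵥ ψ with hφ
  have h1 : (U * diagonal (fun i => (d i : ℂ)) * star U) *ᵥ ψ =
      U *ᵥ (diagonal (fun i => (d i : ℂ)) *ᵥ φ) := by
    rw [hφ, ← mulVec_mulVec, ← mulVec_mulVec]
  have h2 : star ψ ⬝ᵥ (U *ᵥ (diagonal (fun i => (d i : ℂ)) *ᵥ φ)) =
      star φ ⬝ᵥ (diagonal (fun i => (d i : ℂ)) *ᵥ φ) := by
    rw [dotProduct_mulVec, hφ, star_mulVec, star_eq_conjTranspose, conjTranspose_conjTranspose]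
  rw [h1, h2]
  simp only [dotProduct, mulVec_diagonal, Pi.star_apply, Complex.re_sum]
  refine sum_congr rfl fun i _ => ?_
  have : star (φ i) * ((d i : ℂ) * φ i) = ((d i * ‖φ i‖ ^ 2 : ℝ) : ℂ) := by
    rw [Complex.star_def, mul_left_comm, Complex.ofReal_mul, ← Complex.normSq_eq_norm_sq,
      ← Complex.mul_conj, mul_comm (φ i)]
  rw [this, Complex.ofReal_re]

/-- `Σᵢ ‖(U⋆ψ)ᵢ‖² = Re⟨ψ,ψ⟩` for unitary `U`. [folklore] -/
theorem sum_norm_sq_star_mulVec {U : Matrix n n ℂ} (hU : U ∈ unitary (Matrix n n ℂ)) (ψ : n → ℂ) :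
    ∑ i, ‖(star U *ᵥ ψ) i‖ ^ 2 = (star ψ ⬝ᵥ ψ).re := by
  have h := re_quadForm_conj_diagonal U (fun _ => (1 : ℝ)) ψ
  have hd : diagonal (fun _ : n => ((1 : ℝ) : ℂ)) = 1 := by simp
  rw [hd, Matrix.mul_one, Unitary.mul_star_self_of_mem hU, one_mulVec] at h
  rw [h]
  simp

/-- Spectral form of a quadratic form of a Hermitian matrix. [folklore] -/
theorem IsHermitian.re_quadForm_eq_sum {A : Matrix n n ℂ} (hA : A.IsHermitian) (ψ : n → ℂ) :
    (star ψ ⬝ᵥ (A *ᵥ ψ)).re =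
      ∑ i, hA.eigenvalues i * ‖(star (hA.eigenvectorUnitary : Matrix n n ℂ) *ᵥ ψ) i‖ ^ 2 := by
  conv_lhs => rw [hA.eq_conj_diagonal]
  exact re_quadForm_conj_diagonal _ _ ψ

/-- Spectral form of `⟨ψ, e^{-βA} ψ⟩`. [folklore] -/
theorem IsHermitian.re_quadForm_gibbsWeight_eq_sum {A : Matrix n n ℂ} (hA : A.IsHermitian)
    (β : ℝ) (ψ : n → ℂ) :
    (star ψ ⬝ᵥ (gibbsWeight β A *ᵥ ψ)).re =
      ∑ i, Real.exp (-(β * hA.eigenvalues i)) *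
        ‖(star (hA.eigenvectorUnitary : Matrix n n ℂ) *ᵥ ψ) i‖ ^ 2 := by
  rw [hA.gibbsWeight_eq β]
  exact re_quadForm_conj_diagonal _ _ ψ

/-- **Jensen for the vector state**: `Re⟨ψ, e^{-βA}ψ⟩ ≥ exp(-β Re⟨ψ,Aψ⟩)` for unit `ψ`. [folklore] -/
theorem IsHermitian.exp_neg_mul_quadForm_le {A : Matrix n n ℂ} (hA : A.IsHermitian) (β : ℝ)
    (ψ : n → ℂ) (hψ : star ψ ⬝ᵥ ψ = 1) :
    Real.exp (-(β * (star ψ ⬝ᵥ (A *ᵥ ψ)).re)) ≤ (star ψ ⬝ᵥ (gibbsWeight β A *ᵥ ψ)).re := by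
  have hU : (hA.eigenvectorUnitary : Matrix n n ℂ) ∈ unitary (Matrix n n ℂ) :=
    hA.eigenvectorUnitary.prop
  set w : n → ℝ := fun i => ‖(star (hA.eigenvectorUnitary : Matrix n n ℂ) *ᵥ ψ) i‖ ^ 2 with hw
  have hw1 : ∑ i, w i = 1 := by
    rw [hw, sum_norm_sq_star_mulVec hU ψ, hψ]; simp
  rw [hA.re_quadForm_eq_sum ψ, hA.re_quadForm_gibbsWeight_eq_sum β ψ]
  have hJ := (convexOn_exp).map_sum_le (t := (univ : Finset n)) (w := w)
    (p := fun i => -(β * hA.eigenvalues i)) (fun i _ => by positivity) hw1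
    (fun i _ => Set.mem_univ _)
  simp only [smul_eq_mul] at hJ
  have hlhs : -(β * ∑ i, hA.eigenvalues i * w i) = ∑ i, w i * -(β * hA.eigenvalues i) := by
    rw [mul_sum, ← sum_neg_distrib]
    refine sum_congr rfl fun i _ => by ring
  calc Real.exp (-(β * ∑ i, hA.eigenvalues i * w i))
      = Real.exp (∑ i, w i * -(β * hA.eigenvalues i)) := by rw [hlhs]
    _ ≤ ∑ i, w i * Real.exp (-(β * hA.eigenvalues i)) := hJ
    _ = ∑ i, Real.exp (-(β * hA.eigenvalues i)) * w i := sum_congr rfl fun i _ => mul_comm _ _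

/-- **A PSD matrix's trace dominates its quadratic form on unit vectors**:
`Re⟨ψ, Nψ⟩ ≤ Re tr N` for `N ≥ 0`, `‖ψ‖ = 1`. [folklore] -/
theorem PosSemidef.re_quadForm_le_trace {N : Matrix n n ℂ} (hN : N.PosSemidef) (ψ : n → ℂ)
    (hψ : star ψ ⬝ᵥ ψ = 1) : (star ψ ⬝ᵥ (N *ᵥ ψ)).re ≤ N.trace.re := by
  have hNh : N.IsHermitian := hN.isHermitian
  have hU : (hNh.eigenvectorUnitary : Matrix n n ℂ) ∈ unitary (Matrix n n ℂ) :=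
    hNh.eigenvectorUnitary.prop
  set w : n → ℝ := fun i => ‖(star (hNh.eigenvectorUnitary : Matrix n n ℂ) *ᵥ ψ) i‖ ^ 2 with hw
  have hw1 : ∑ i, w i = 1 := by
    rw [hw, sum_norm_sq_star_mulVec hU ψ, hψ]; simp
  have hwle : ∀ i, w i ≤ 1 := fun i => by
    rw [← hw1]; exact single_le_sum (fun j _ => by positivity) (mem_univ i)
  rw [hNh.re_quadForm_eq_sum ψ, hNh.trace_eq_sum_eigenvalues, Complex.re_sum]
  refine sum_le_sum fun i _ => ?_
  have h0 : 0 ≤ hNh.eigenvalues i := hN.eigenvalues_nonneg i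
  calc hNh.eigenvalues i * w i ≤ hNh.eigenvalues i * 1 :=
        mul_le_mul_of_nonneg_left (hwle i) h0
    _ = hNh.eigenvalues i := mul_one _
    _ = _ := by simp

/-- **Peierls–Jensen in a sector.** `P` an idempotent Hermitian commuting with the Hermitian `K`,
`ψ` a unit vector with `Pψ = ψ`: `Re tr (P e^{-βK}) ≥ exp(-β Re⟨ψ, Kψ⟩)`. [folklore] -/
theorem sectorZ_ge_exp_quadForm {P K : Matrix n n ℂ} (hP : P * P = P) (hPh : P.IsHermitian)
    (hPK : Commute P K) (hK : K.IsHermitian) (β : ℝ) (ψ : n → ℂ) (hPψ : P *ᵥ ψ = ψ)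
    (hψ : star ψ ⬝ᵥ ψ = 1) :
    Real.exp (-(β * (star ψ ⬝ᵥ (K *ᵥ ψ)).re)) ≤ (P * gibbsWeight β K).trace.re := by
  -- `e^{-βK}` commutes with `P`
  have hPW : Commute P (gibbsWeight β K) := by
    have : Commute P (-(β : ℂ) • K) := (hPK.smul_right _)
    exact this.exp_right
  -- `tr (P W) = tr (P W P)` and `P W P ≥ 0`
  have hW : (gibbsWeight β K).PosSemidef := (posDef_gibbsWeight β hK).posSemidef
  have hPWP : (P * gibbsWeight β K * P).PosSemidef := by
    have := hW.conjTranspose_mul_mul_same P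
    rwa [hPh.eq] at this
  have htr : (P * gibbsWeight β K).trace = (P * gibbsWeight β K * P).trace := by
    rw [Matrix.mul_assoc, ← hPW.eq, ← Matrix.mul_assoc, hP]
  -- the quadratic form of `P W P` at `ψ` is that of `W`
  have hv : star ψ ᵥ* P = star ψ := by
    conv_lhs => rw [← hPh.eq]
    rw [vecMul_conjTranspose, star_star, hPψ]
  have hquad : star ψ ⬝ᵥ ((P * gibbsWeight β K * P) *ᵥ ψ) =
      star ψ ⬝ᵥ (gibbsWeight β K *ᵥ ψ) := by
    rw [← mulVec_mulVec, ← mulVec_mulVec, hPψ, dotProduct_mulVec, hv]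
  rw [htr]
  calc Real.exp (-(β * (star ψ ⬝ᵥ (K *ᵥ ψ)).re))
      ≤ (star ψ ⬝ᵥ (gibbsWeight β K *ᵥ ψ)).re := hK.exp_neg_mul_quadForm_le β ψ hψ
    _ = (star ψ ⬝ᵥ ((P * gibbsWeight β K * P) *ᵥ ψ)).re := by rw [hquad]
    _ ≤ (P * gibbsWeight β K * P).trace.re := hPWP.re_quadForm_le_trace ψ hψ

/-- **Softmin ≤ eigenvector expectation** (the first inequality of the card): with
`K = H - e·1 + B`, `Hψ = eψ`, `Pψ = ψ`, `‖ψ‖ = 1`,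
`-(1/β) log Re tr (P e^{-βK}) ≤ Re⟨ψ, Bψ⟩`. [folklore] -/
theorem softmin_le_expect' {P H B : Matrix n n ℂ} (hP : P * P = P) (hPh : P.IsHermitian)
    (hPH : Commute P H) (hPB : Commute P B) (hH : H.IsHermitian) (hB : B.IsHermitian)
    {β : ℝ} (hβ : 0 < β) (e : ℝ) (ψ : n → ℂ) (hPψ : P *ᵥ ψ = ψ) (hψ : star ψ ⬝ᵥ ψ = 1)
    (hHψ : H *ᵥ ψ = ((e : ℝ) : ℂ) • ψ) :
    -(1 / β) * Real.log (P * gibbsWeight β (H - ((e : ℝ) : ℂ) • (1 : Matrix n n ℂ) + B)).trace.re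
      ≤ (star ψ ⬝ᵥ (B *ᵥ ψ)).re := by
  set K : Matrix n n ℂ := H - ((e : ℝ) : ℂ) • (1 : Matrix n n ℂ) + B with hKdef
  have hK : K.IsHermitian := by
    rw [hKdef]
    refine IsHermitian.add (IsHermitian.sub hH ?_) hB
    unfold Matrix.IsHermitian
    rw [conjTranspose_smul, conjTranspose_one, Complex.star_def, Complex.conj_ofReal]
  have hPK : Commute P K := by
    rw [hKdef]
    exact (hPH.sub_right ((Commute.one_right P).smul_right _)).add_right hPB
  -- `⟨ψ, Kψ⟩ = ⟨ψ, Bψ⟩`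
  have hKψ : (star ψ ⬝ᵥ (K *ᵥ ψ)).re = (star ψ ⬝ᵥ (B *ᵥ ψ)).re := by
    have : K *ᵥ ψ = B *ᵥ ψ := by
      rw [hKdef, add_mulVec, sub_mulVec, hHψ, smul_mulVec, one_mulVec, sub_self, zero_add]
    rw [this]
  have hZ := sectorZ_ge_exp_quadForm hP hPh hPK hK β ψ hPψ hψ
  rw [hKψ] at hZ
  have hZpos : 0 < (P * gibbsWeight β K).trace.re := lt_of_lt_of_le (Real.exp_pos _) hZ
  have hlog : -(β * (star ψ ⬝ᵥ (B *ᵥ ψ)).re) ≤ Real.log (P * gibbsWeight β K).trace.re := by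
    rw [← Real.log_exp (-(β * (star ψ ⬝ᵥ (B *ᵥ ψ)).re))]
    exact Real.log_le_log (Real.exp_pos _) hZ
  have hβ' : 0 < 1 / β := by positivity
  have := mul_le_mul_of_nonneg_left hlog hβ'.le
  have hcancel : 1 / β * -(β * (star ψ ⬝ᵥ (B *ᵥ ψ)).re) = -(star ψ ⬝ᵥ (B *ᵥ ψ)).re := by
    field_simp
  rw [hcancel] at this
  linarith

end Matrix

end SoftminProved

namespace Summit.HubbardSuperconductivity.HubbardSuperconductivity.Cruxes.BirGroundStateAverageLRO.SketchIdeator2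

open Matrix Literature.MathematicalPhysics.QuantumLattice Literature.Probability.LatticeModels
open Summit.HubbardSuperconductivity.HubbardSuperconductivity.Theses.BalabanIR
open scoped ComplexOrder

/-! ## §1 Abstract softmin lemmas (finite-dimensional, sector form) -/

section Abstract

variable {n : Type*} [Fintype n] [DecidableEq n]

/-- Sector partition function `Z^P_β(K) = Re tr (P e^{-βK})` for an idempotent `P` commuting with `K`. -/
def sectorZ (P : Matrix n n ℂ) (β : ℝ) (K : Matrix n n ℂ) : ℝ :=
  (P * gibbsWeight β K).trace.re

/-- Sector Gibbs expectation `⟨A⟩^P_{β,K} = Re tr (P e^{-βK} A) / Z^P_β(K)`. -/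
def sectorExpect (P : Matrix n n ℂ) (β : ℝ) (K A : Matrix n n ℂ) : ℝ :=
  (P * gibbsWeight β K * A).trace.re / sectorZ P β K

/-- The softmin functional `-(1/β) log Z^P_β(H - e·1 + B)`. -/
def softmin (P : Matrix n n ℂ) (β e : ℝ) (H B : Matrix n n ℂ) : ℝ :=
  -(1 / β) * Real.log (sectorZ P β (H - ((e : ℝ) : ℂ) • (1 : Matrix n n ℂ) + B))

/-- **Softmin ≤ every eigenvector expectation — PROVED** (Peierls' inequality for the vector state `ψ`:
`tr_P e^{-βK} ≥ e^{-β⟨ψ,Kψ⟩}` and `⟨ψ, K ψ⟩ = ⟨ψ, B ψ⟩` for `K = H - e + B`, `Hψ = eψ`). Needs only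
that `ψ` is an eigenvector IN the sector, not that `e` is minimal. [folklore] -/
theorem softmin_le_expect (P H B : Matrix n n ℂ) (hP : P * P = P) (hPh : P.IsHermitian)
    (hPH : Commute P H) (hPB : Commute P B) (hH : H.IsHermitian) (hB : B.IsHermitian)
    {β : ℝ} (hβ : 0 < β) (e : ℝ) (ψ : n → ℂ) (hPψ : P *ᵥ ψ = ψ) (hψ1 : star ψ ⬝ᵥ ψ = 1)
    (hHψ : H *ᵥ ψ = ((e : ℝ) : ℂ) • ψ) :
    softmin P β e H B ≤ (star ψ ⬝ᵥ (B *ᵥ ψ)).re := by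
  unfold softmin sectorZ
  exact Matrix.softmin_le_expect' hP hPh hPH hPB hH hB hβ e ψ hPψ hψ1 hHψ

/-- **Gibbs step with the free entropy budget**: if `e` is the lowest energy of `H` on the sector
`P` (variationally: `e ≤ Re⟨φ,Hφ⟩` for unit `φ` with `Pφ = φ`), then
`⟨B⟩^P_{β,H+B} - log(Re tr P)/β ≤ softmin` (Gibbs variational principle
`F^P_β(H+B) = ⟨H+B⟩ - T S`, `S ≤ log dim P`, and `e ≤ ⟨H⟩_{ρ}`). [folklore] -/
theorem sectorExpect_sub_logdim_le_softmin (P H B : Matrix n n ℂ) (hP : P * P = P)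
    (hPh : P.IsHermitian) (hP0 : P ≠ 0) (hPH : Commute P H) (hPB : Commute P B)
    (hH : H.IsHermitian) (hB : B.IsHermitian) {β : ℝ} (hβ : 0 < β) (e : ℝ)
    (he : ∀ φ : n → ℂ, P *ᵥ φ = φ → star φ ⬝ᵥ φ = 1 → e ≤ (star φ ⬝ᵥ (H *ᵥ φ)).re) :
    sectorExpect P β (H + B) B - Real.log (P.trace.re) / β ≤ softmin P β e H B := by
  sorry

/-- **Gibbs step, entropy-priced form** (the dial of the card): with the thermally-accessible
state count `log 𝒩 := log Re tr (P e^{-β(H - e)}) ≤ σ` of the UNPERTURBED `H` one has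
`[F^P_β(H+B) - F^P_β(H)] - σ/β ≤ softmin`, `F^P_β(K) := -(1/β) log Z^P_β(K)`. [folklore] -/
theorem freeEnergyGap_sub_le_softmin (P H B : Matrix n n ℂ) (hP : P * P = P)
    (hPh : P.IsHermitian) (hP0 : P ≠ 0) (hPH : Commute P H) (hPB : Commute P B)
    (hH : H.IsHermitian) (hB : B.IsHermitian) {β σ : ℝ} (hβ : 0 < β) (e : ℝ)
    (hσ : Real.log (sectorZ P β (H - ((e : ℝ) : ℂ) • (1 : Matrix n n ℂ))) ≤ σ) :
    (-(1 / β) * Real.log (sectorZ P β (H + B))) - (-(1 / β) * Real.log (sectorZ P β H)) - σ / β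
      ≤ softmin P β e H B := by
  sorry

/-- **Monotonicity in the penalty** (concavity of `s ↦ F^P_β(H + sB)`): the free-energy gap
dominates `⟨B⟩` in the penalised state, `⟨B⟩^P_{β,H+B} ≤ F^P_β(H+B) - F^P_β(H)`. [folklore] -/
theorem sectorExpect_le_freeEnergyGap (P H B : Matrix n n ℂ) (hP : P * P = P)
    (hPh : P.IsHermitian) (hP0 : P ≠ 0) (hPH : Commute P H) (hPB : Commute P B)
    (hH : H.IsHermitian) (hB : B.IsHermitian) {β : ℝ} (hβ : 0 < β) :
    sectorExpect P β (H + B) B ≤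
      (-(1 / β) * Real.log (sectorZ P β (H + B))) - (-(1 / β) * Real.log (sectorZ P β H)) := by
  sorry

/-- **Araki–Lieb–Thirring slicing** (the engine may use its own time-sliced penalty): for
Hermitian `H`, `B` and `r ≥ 1` slices, `Z_β(H + B) ≤ Re tr [(e^{-βH/(2r)} e^{-βB/r} e^{-βH/(2r)})^r]`
(Golden–Thompson is `r = 1`; the bound decreases to `Z_β(H+B)` along `r → 2r`). Stated on the
full algebra; the sector form inserts `P`. [folklore] -/
theorem partitionFn_le_slicedTrace (H B : Matrix n n ℂ) (hH : H.IsHermitian) (hB : B.IsHermitian)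
    {β : ℝ} (hβ : 0 < β) (r : ℕ) (hr : 1 ≤ r) :
    (partitionFn β (H + B)).re ≤
      ((gibbsWeight (β / (2 * r)) H * gibbsWeight (β / r) B * gibbsWeight (β / (2 * r)) H) ^ r).trace.re := by
  sorry

end Abstract

/-! ## §2 The typed transfer target for the crux -/

/-- **C⁺ (R1, tower schedule) — `PenalisedThermalFloor δ U₁ U₂ κ x θ`.** For every `U` in the
window, eventually in even `L`: the CANONICAL `(N_L, S^z = 0)` Gibbs state at inverse temperature
`β_L = θ·L²` of the PENALISED torus Hamiltonian `K = hubbardTorus 2 L 1 U + (κ/L⁴)·A`,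
`A = (pairField d)ᴴ(pairField d)` (`= 2Δ_d†Δ_d`), has `⟨A⟩ ≥ x·L⁴` — written as
`x·L⁴·Re tr(P_S e^{-βK}) ≤ Re tr(P_S e^{-βK} A)` with `P_S` the sector projection. The penalty has
operator norm `O(κ)` uniformly in `L`; `κ` must stay below the twist threshold `2π²Υ/x`. -/
def PenalisedThermalFloor (δ U₁ U₂ κ x θ : ℝ) : Prop :=
  ∀ U ∈ Set.Ioo U₁ U₂, ∃ L₀ : ℕ, ∀ (L : ℕ) [NeZero L], L₀ ≤ L → Even L →
    let N : ℕ := 2 * ⌊(1 - δ) * (L : ℝ) ^ 2 / 2⌋₊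
    let H := hubbardTorus 2 L 1 U
    let S := szSector (Λ := FermionTorus 2 L) N 0
    let P := projMatrix (S.map (Fock.toEuclidean (ι := Orb (FermionTorus 2 L)) :
      Fock (Orb (FermionTorus 2 L)) →ₗ[ℂ] EuclideanSpace ℂ (Finset (Orb (FermionTorus 2 L)))))
    let A := (pairField dWaveFormFactor L)ᴴ * pairField dWaveFormFactor L
    let K := H + ((κ / (L : ℝ) ^ 4 : ℝ) : ℂ) • A
    let β : ℝ := θ * (L : ℝ) ^ 2
    x * (L : ℝ) ^ 4 * (P * gibbsWeight β K).trace.re ≤ (P * gibbsWeight β K * A).trace.re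

/-- **C⁺ (R2, isotropic schedule with the entropy dial) — `PenalisedIsotropicFloor`.** Same, at
`β_L = θ·L` (space-time isotropic up to `v`), together with the entropy/state-count hypothesis
`log Re tr(P_S e^{-β(H - e_S)}) ≤ C·L/θ` (`e_S = minEnergyOn H S`; an `S_β ≤ C L² T`-grade bound,
cf. ThermalWedge's `stub_entropyDensity`). -/
def PenalisedIsotropicFloor (δ U₁ U₂ κ x θ C : ℝ) : Prop :=
  ∀ U ∈ Set.Ioo U₁ U₂, ∃ L₀ : ℕ, ∀ (L : ℕ) [NeZero L], L₀ ≤ L → Even L →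
    let N : ℕ := 2 * ⌊(1 - δ) * (L : ℝ) ^ 2 / 2⌋₊
    let H := hubbardTorus 2 L 1 U
    let S := szSector (Λ := FermionTorus 2 L) N 0
    let P := projMatrix (S.map (Fock.toEuclidean (ι := Orb (FermionTorus 2 L)) :
      Fock (Orb (FermionTorus 2 L)) →ₗ[ℂ] EuclideanSpace ℂ (Finset (Orb (FermionTorus 2 L)))))
    let A := (pairField dWaveFormFactor L)ᴴ * pairField dWaveFormFactor L
    let K := H + ((κ / (L : ℝ) ^ 4 : ℝ) : ℂ) • A
    let β : ℝ := θ * (L : ℝ)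
    let e : ℝ := H.minEnergyOn S
    x * (L : ℝ) ^ 4 * (P * gibbsWeight β K).trace.re ≤ (P * gibbsWeight β K * A).trace.re ∧
      Real.log ((P * gibbsWeight β (H - ((e : ℝ) : ℂ) • 1)).trace.re) ≤ C * (L : ℝ) / θ

/-- **Transfer (R1)**: the penalised thermal floor on the tower schedule `β_L = θL²` with
`θκx ≥ 4·log 4` (entropy budget `log dim S ≤ L² log 4`) gives the crux with `c = x/2` — in fact it
gives `⟨A⟩ ≥ (x/2)L⁴` for EVERY normalised sector ground state, and the crux follows by the landed
`Theorems.birGroundStateAverageLRO_of_forall_groundState`. -/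
theorem transfer_tower (δ U₁ U₂ κ x θ : ℝ) (hδ : δ ∈ Set.Ioo (0 : ℝ) (1 / 2)) (hU₁ : 0 < U₁)
    (hU₁₂ : U₁ < U₂) (hκ : 0 < κ) (hx : 0 < x) (hθ : 4 * Real.log 4 ≤ θ * κ * x)
    (h : PenalisedThermalFloor δ U₁ U₂ κ x θ) : BirGroundStateAverageLRO := by
  sorry

/-- **Transfer (R2)**: the isotropic form with `θ² κ x ≥ 4C`. -/
theorem transfer_isotropic (δ U₁ U₂ κ x θ C : ℝ) (hδ : δ ∈ Set.Ioo (0 : ℝ) (1 / 2))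
    (hU₁ : 0 < U₁) (hU₁₂ : U₁ < U₂) (hκ : 0 < κ) (hx : 0 < x) (hθ : 0 < θ)
    (hC : 4 * C ≤ θ ^ 2 * κ * x) (h : PenalisedIsotropicFloor δ U₁ U₂ κ x θ C) :
    BirGroundStateAverageLRO := by
  sorry

/-! ## §3 Shrinking-circle delivery: the sector trace as a `U(1) × U(1)` Fourier coefficient -/

/-- Particle-number-and-spin twisted trace `t(φ, χ) = tr (U(φ,χ) X)` with the character operator
`U(φ,χ) = Σ_{N,M} e^{i(φN + χ·2M)} P_{(N,M)}` written through the sector projections (so no matrix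
exponential is needed): the generating function a grand-canonical engine computes with twisted
temporal boundary conditions (imaginary chemical potential `iφ/β`, imaginary field `iχ/β`). -/
def twistedTrace {L : ℕ} [NeZero L]
    (X : Matrix (Finset (Orb (FermionTorus 2 L))) (Finset (Orb (FermionTorus 2 L))) ℂ) (φ χ : ℝ) : ℂ :=
  ∑ N ∈ Finset.range (2 * L ^ 2 + 1), ∑ k ∈ Finset.range (2 * L ^ 2 + 1),
    Complex.exp (Complex.I * ((φ * N + χ * ((k : ℝ) - L ^ 2) : ℝ) : ℂ)) *
      (projMatrix ((szSector (Λ := FermionTorus 2 L) N (((k : ℝ) - L ^ 2) / 2)).map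
          (Fock.toEuclidean (ι := Orb (FermionTorus 2 L)) :
            Fock (Orb (FermionTorus 2 L)) →ₗ[ℂ] EuclideanSpace ℂ (Finset (Orb (FermionTorus 2 L))))) *
        X).trace

/-- **Fourier projection identity** (orthogonality of characters): the `(N, S^z = 0)` sector trace
is the `(N, 0)` Fourier coefficient of the twisted trace over the torus of imaginary potentials. It
is through this double integral — on circles of radius `π/β_L → 0` in `Im μ`, `Im h` — that the
grand-canonical output of an engine at `β_L → ∞` feeds `PenalisedThermalFloor`. [folklore] -/
theorem sectorTrace_eq_fourier {L : ℕ} [NeZero L] (N : ℕ) (hN : N ≤ 2 * L ^ 2)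
    (X : Matrix (Finset (Orb (FermionTorus 2 L))) (Finset (Orb (FermionTorus 2 L))) ℂ) :
    (projMatrix ((szSector (Λ := FermionTorus 2 L) N 0).map
        (Fock.toEuclidean (ι := Orb (FermionTorus 2 L)) :
          Fock (Orb (FermionTorus 2 L)) →ₗ[ℂ] EuclideanSpace ℂ (Finset (Orb (FermionTorus 2 L))))) *
      X).trace =
      (1 / (2 * Real.pi) ^ 2 : ℂ) *
        ∫ φ in (0 : ℝ)..(2 * Real.pi), ∫ χ in (0 : ℝ)..(2 * Real.pi),
          Complex.exp (-(Complex.I * ((φ * N : ℝ) : ℂ))) * twistedTrace X φ χ := by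
  sorry

end Summit.HubbardSuperconductivity.HubbardSuperconductivity.Cruxes.BirGroundStateAverageLRO.SketchIdeator2
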